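import Summits.NavierStokesRegularity.NavierStokesRegularity.Theorems.ExtremiserTransienceNearExtremalTransienceExtremiserLiouvilleConstantSpeedSlabRate
import Summits.NavierStokesRegularity.NavierStokesRegularity.Theorems.ExtremiserTransienceNearExtremalTransienceExtremiserLiouvilleConstantSpeedSlabCorrector
import HarnessLib

/-!
# Crux `ExtremiserTransience.NearExtremalTransience` (stmt-NavierStokesRegularity-21883), line `extremiser_liouville`,
# stub K1b — THE SLAB RATE, UNCONDITIONAL AND PACKAGED: `∫_S ‖ω‖², ∫_S |Dω|²_F, ∫_S |Dv|²_F = O(1/R)` on bounded `S ⊆ {R/2 ≤ x₂ ≤ 6R}`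

`--supports stmt-NavierStokesRegularity-21883` (helper).  Author: prover seat `ns-el-k1b` (g7).  `slabRate_of_corrector_bound`
(`…ConstantSpeedSlabRate`) with its two hypotheses discharged: the far-field smallness `‖v − c‖ ≤ κ⋆M/3` on `{x₂ ≥ R/4}` for
`R ≥ R₀` (from `v → c` at infinity and `‖x‖ ≥ x₂`) and the corrector bound (`…ConstantSpeedSlabCorrector.slabCorrector_bound`);
the cut-off weight is removed by taking `ρ` larger than the bounded set:

* `setIntegral_le_integral_mul_of_eq_one` — `∫_S f ≤ ∫ θ·f` for `f ≥ 0` continuous, `θ ≥ 0` with `θ = 1` on the bounded set `S`;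
* `jet_slabRate` — **for the constant-speed axial residue JET there are `C ≥ 0` and `R₀ ≥ 1` such that for every `R ≥ R₀` and every
  bounded measurable `S ⊆ {R/2 ≤ x₂ ≤ 6R}`:  `W·∫_S‖ω‖² + Z·∫_S|Dω|²_F ≤ C/R` and `∫_S|Dv|²_F ≤ C/R`.**
In words: enstrophy, palinstrophy and gradient energy per unit HEIGHT decay like `z⁻²` along the jet, for every jet residue
(thin, conical or pancake), while the excess energy per unit height is the constant `E₀`.

WHAT THIS IS NOT: K1b is NOT proved; nothing here proves NS regularity. [folklore]
-/

noncomputable section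

open Set Filter Topology MeasureTheory Metric Function Real Bornology
open scoped ENNReal NNReal Topology InnerProductSpace RealInnerProductSpace ContDiff

namespace Summit.NavierStokesRegularity.NavierStokesRegularity.Theorems

-- the problem directory repeats the summit name (`NavierStokesRegularity/NavierStokesRegularity`)
set_option linter.dupNamespace false

namespace ExtremiserLiouville

open Literature.Analysis.FluidPDE Literature.Analysis
open DepletionLadder.KStar DepletionLadder.KStar.HalfSpace

variable {v : E3 → E3} {c : E3}

/-- `∫_S f ≤ ∫ θ·f` for `f ≥ 0` continuous, `θ ≥ 0` continuous with compact support and `θ = 1` on the bounded measurable set `S`.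
[folklore] -/
theorem setIntegral_le_integral_mul_of_eq_one {f θ : E3 → ℝ} (hf : Continuous f) (hf0 : ∀ x, 0 ≤ f x) (hθ : Continuous θ)
    (hθc : HasCompactSupport θ) (hθ0 : ∀ x, 0 ≤ θ x) {S : Set E3} (hS : MeasurableSet S) (hSb : IsBounded S)
    (hθ1 : ∀ x ∈ S, θ x = 1) :
    (∫ x in S, f x) ≤ ∫ x, θ x * f x := by
  obtain ⟨ρ, hρ⟩ := (Metric.isBounded_iff_subset_closedBall (0 : E3)).1 hSb
  have hiS : IntegrableOn f S volume :=
    (hf.continuousOn.integrableOn_compact (isCompact_closedBall (0 : E3) ρ)).mono_set hρ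
  rw [← integral_indicator hS]
  refine integral_mono ((integrable_indicator_iff hS).2 hiS) ((hθ.mul hf).integrable_of_hasCompactSupport hθc.mul_right)
    fun x => ?_
  by_cases hx : x ∈ S
  · rw [indicator_of_mem hx, hθ1 x hx, one_mul]
  · rw [indicator_of_notMem hx]; exact mul_nonneg (hθ0 x) (hf0 x)

/-- **THE SLAB RATE OF THE RESIDUE JET (unconditional).**  See the module docstring. [folklore] -/
theorem jet_slabRate
    (hv : ContDiff ℝ ∞ v) (hdiv : VectorCalculus.IsDivFree v) {M B : ℝ} (hMpos : 0 < M)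
    (hM : ∀ x, ‖v x‖ = M) (hcM : ‖c‖ = M) (hB : ∀ x, ‖fderiv ℝ v x‖ ≤ B)
    (h1 : ∫⁻ x, ‖iteratedFDeriv ℝ 1 v x‖ₑ ^ 2 < ⊤) (h2 : ∫⁻ x, ‖iteratedFDeriv ℝ 2 v x‖ₑ ^ 2 < ⊤)
    (hpos : 0 < M * Real.sqrt (Zen v) * Real.sqrt (Wpa v))
    (hatt : |Jst v| = kStar * M * Real.sqrt (Zen v) * Real.sqrt (Wpa v))
    (hc0 : c 0 = 0) (hc1 : c 1 = 0) (hc2 : c 2 ≠ 0)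
    (hfar : Tendsto (fun x => v x - c) (cocompact E3) (𝓝 0))
    (hslab : ∀ T : ℝ, 0 < T → Integrable (fun x => {x : E3 | |x 2| ≤ T}.indicator (fun x => ‖v x - c‖ ^ 2) x) volume)
    {E₀ : ℝ} (hE0 : 0 ≤ E₀) (hE : ∀ s : ℝ, (∫ x, deriv Real.smoothTransition (x 2 - s) * ‖v x - c‖ ^ 2) = E₀) :
    ∃ C : ℝ, 0 ≤ C ∧ ∃ R₀ : ℝ, 1 ≤ R₀ ∧ ∀ R : ℝ, R₀ ≤ R → ∀ S : Set E3, MeasurableSet S → IsBounded S →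
      S ⊆ {x : E3 | R / 2 ≤ x 2 ∧ x 2 ≤ 6 * R} →
      Wpa v * (∫ x in S, ‖curl v x‖ ^ 2) + Zen v * (∫ x in S, frobeniusNormSq (fderiv ℝ (curl v) x)) ≤ C / R ∧
      (∫ x in S, frobeniusNormSq (fderiv ℝ v x)) ≤ C / R := by
  have hK0 : 0 < kStar := kStar_pos
  obtain ⟨Cη, hCη, hcorr⟩ := slabCorrector_bound hv hdiv hMpos hM hcM hc0 hc1 hc2 hslab hE0 hE
  obtain ⟨C, hC0, hC⟩ := slabRate_of_corrector_bound hv hdiv hMpos hM hcM hB h1 h2 hpos hatt hc0 hc1 hc2 hslab hE0 hE hCη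
  -- far field
  obtain ⟨r₀, hr₀⟩ : ∃ r₀ : ℝ, ∀ x : E3, r₀ ≤ ‖x‖ → ‖v x - c‖ ≤ kStar * M / 3 := by
    have hδ : 0 < kStar * M / 3 := by positivity
    have h : (fun x => v x - c) ⁻¹' Metric.ball (0 : E3) (kStar * M / 3) ∈ cocompact E3 :=
      hfar (Metric.ball_mem_nhds (0 : E3) hδ)
    rw [mem_cocompact] at h
    obtain ⟨Kc, hKc, hKsub⟩ := h
    obtain ⟨ρ, hρ⟩ := (Metric.isBounded_iff_subset_closedBall (0 : E3)).1 hKc.isBounded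
    refine ⟨ρ + 1, fun x hx => ?_⟩
    have hxK : x ∉ Kc := fun hmem => by
      have := hρ hmem; rw [mem_closedBall, dist_zero_right] at this; linarith
    have := hKsub hxK
    rw [mem_preimage, Metric.mem_ball, dist_zero_right] at this
    exact this.le
  refine ⟨C, hC0, max 1 (4 * r₀), le_max_left _ _, fun R hR S hS hSb hSsub => ?_⟩
  have hR1 : 1 ≤ R := (le_max_left _ _).trans hR
  have hR0 : 0 < R := one_pos.trans_le hR1
  have hR4 : 4 * r₀ ≤ R := (le_max_right _ _).trans hR
  have hσR : ∀ x : E3, R / 4 ≤ x 2 → ‖v x - c‖ ≤ kStar * M / 3 := fun x hx =>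
    hr₀ x ((by linarith : r₀ ≤ R / 4).trans (norm_ge_of_mem_slab hx))
  obtain ⟨ρ₀, hρ₀R, hρ₀⟩ := hcorr R hR1
  obtain ⟨ρ₁, hρ₁⟩ := (Metric.isBounded_iff_subset_closedBall (0 : E3)).1 hSb
  set ρ : ℝ := max ρ₀ ρ₁ with hρdef
  have hRρ : R ≤ ρ := hρ₀R.trans (le_max_left _ _)
  have hρ0 : 0 < ρ := hR0.trans_le hRρ
  obtain ⟨hmain, hgrad⟩ := hC R ρ hR1 hRρ hσR (hρ₀ ρ (le_max_left _ _))
  -- the cut-off is `1` on `S`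
  set θ : E3 → ℝ := fun x : E3 => Real.smoothTransition (4 * (R⁻¹ * x 2) - 1) * Real.smoothTransition (4 - R⁻¹ * x 2 / 2) *
    cutoff ρ x with hθdef
  have hθ : ContDiff ℝ ∞ θ := contDiff_axialCutoff R ρ
  have hθc : HasCompactSupport θ := hasCompactSupport_axialCutoff R hρ0
  have hθ0 : ∀ x, 0 ≤ θ x := fun x => (axialCutoff_nonneg_le_one R ρ x).1
  have hθ1 : ∀ x ∈ S, θ x = 1 := by
    intro x hx
    have hx' := hSsub hx
    have hxn : ‖x‖ ≤ ρ := by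
      have := hρ₁ hx; rw [mem_closedBall, dist_zero_right] at this; exact this.trans (le_max_right _ _)
    exact axialCutoff_eq_one hR0 hρ0 hx'.1 hx'.2 hxn
  -- continuity data
  have cω : Continuous (curl v) := (contDiff_curl_top hv).continuous
  have hv1 : ContDiff ℝ 1 v := hv.of_le (by norm_cast)
  have cF : Continuous (fun x => frobeniusNormSq (fderiv ℝ (curl v) x)) :=
    continuous_frobeniusNormSq_fderiv ((contDiff_curl_top hv).of_le (by norm_cast)) one_ne_zero
  have cFv : Continuous (fun x => frobeniusNormSq (fderiv ℝ v x)) := continuous_frobeniusNormSq_fderiv hv1 one_ne_zero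
  have hZS := setIntegral_le_integral_mul_of_eq_one (cω.norm.pow 2) (fun x => sq_nonneg _) hθ.continuous hθc hθ0 hS hSb hθ1
  have hWS := setIntegral_le_integral_mul_of_eq_one cF (fun x => frobeniusNormSq_nonneg _) hθ.continuous hθc hθ0 hS hSb hθ1
  have hDS := setIntegral_le_integral_mul_of_eq_one cFv (fun x => frobeniusNormSq_nonneg _) hθ.continuous hθc hθ0 hS hSb hθ1
  have hZ0 : 0 ≤ Zen v := integral_nonneg fun x => sq_nonneg _
  have hW0 : 0 ≤ Wpa v := integral_nonneg fun x => frobeniusNormSq_nonneg _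
  refine ⟨?_, hDS.trans hgrad⟩
  calc Wpa v * (∫ x in S, ‖curl v x‖ ^ 2) + Zen v * (∫ x in S, frobeniusNormSq (fderiv ℝ (curl v) x))
      ≤ Wpa v * (∫ x, θ x * ‖curl v x‖ ^ 2) + Zen v * (∫ x, θ x * frobeniusNormSq (fderiv ℝ (curl v) x)) :=
        add_le_add (mul_le_mul_of_nonneg_left hZS hW0) (mul_le_mul_of_nonneg_left hWS hZ0)
    _ ≤ C / R := hmain

end ExtremiserLiouville

end Summit.NavierStokesRegularity.NavierStokesRegularity.Theorems

end
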